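import Mathlib
import HarnessLib
import Literature.Analysis.FluidPDE.TaoFiniteEnergyLerayHopf
import Summits.NavierStokesRegularity.NavierStokesRegularity.Theorems.QuarterLogPincerThinCascadeDefs
import Summits.NavierStokesRegularity.NavierStokesRegularity.Theorems.QuarterLogPincerTypeIQuantSubcubicExpZoomLimit
import Summits.NavierStokesRegularity.NavierStokesRegularity.Theorems.QuarterLogPincerTruncationEdgeAnatomyDefs

/-!
# Crux `QuarterLogPincer.TypeIQuantSubcubicExp` (stmt-NavierStokesRegularity-24077), EDGE line `truncation_edge` (ns-idea-7 g8/g9):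
# piece **P4 `stub_exteriorCube : StubExteriorCube` BY NAME** — the exterior cube of a Tao-frame truncation

Prover file (pub-ns-dss typer g35; `--supports stmt-NavierStokesRegularity-24077`, helper).  P4 `ExteriorCube` of the line's T1 anatomy
(objects VERBATIM in `…TruncationEdgeAnatomyDefs`) asks for the log-shaped exterior budget `‖1_{|x|>2ρ} u(t)‖₃ ≤ k`, `k³ ≤ K(1 + log ρ)`,
for Tao-frame solutions from data supported in `B̄(2ρ)` with energy `≤ K₁ρ`, GIVEN the outer sup bound `‖u(t,x)‖ ≤ K₀/ρ` for
`‖x‖ ≥ ρ` (which P3(c) supplies).  As typed this needs no heat-leakage or off-diagonal Oseen bookkeeping: by INTERPOLATION and the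
ENERGY INEQUALITY of Tao-frame solutions (`taoFrame_lintegral_enorm_sq_le`, from the tree's `isLerayHopfOn_of_finiteEnergy`, Tao 2013
Lemma 8.1 with Lemma 4.1 (i)), `∫_{|x|>2ρ}|u(t)|³ ≤ (K₀/ρ)·‖u(t)‖₂² ≤ (K₀/ρ)·K₁ρ = K₀K₁`, so `k = (K₀K₁)^{1/3}`, `K := K₀K₁`, `ρ₀ := 1`.

HONEST FRAME: a statement about hypothetical objects; P3b, T1, 24077, 22144, W7 and NS regularity OPEN / not proved.
-/

noncomputable section

set_option linter.dupNamespace false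

namespace Summit.NavierStokesRegularity.NavierStokesRegularity.Cruxes.TypeIQuantSubcubicExp.TruncationEdge

open MeasureTheory Set Function Metric Filter Topology Real
open scoped ENNReal NNReal ContDiff
open Literature.Analysis Literature.Analysis.FluidPDE
open Summit.NavierStokesRegularity.NavierStokesRegularity.Cruxes.TypeIQuantSubcubicExp.ThinCascade (TaoFrame)
open Summit.NavierStokesRegularity.NavierStokesRegularity.Theorems.ThinCascade (frame_finite_energy)

/-! ## The energy inequality of a Tao-frame solution -/

/-- A Tao-frame solution obeys the energy inequality `∫ |u(t)|² ≤ ∫ |u(0)|²` (finite-energy classical solutions are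
Leray–Hopf: the tree's `isLerayHopfOn_of_finiteEnergy`, Tao 2013 Lemma 8.1 with Lemma 4.1 (i)). [cite: Tao2011, Lemma 8.1] -/
theorem taoFrame_lintegral_enorm_sq_le {T : ℝ} {u : ℝ → EuclideanSpace ℝ (Fin 3) → EuclideanSpace ℝ (Fin 3)}
    {p : ℝ → EuclideanSpace ℝ (Fin 3) → ℝ} (hu : TaoFrame T u p) (hT : 0 < T) {t : ℝ} (ht : t ∈ Icc 0 T) :
    ∫⁻ x, ‖u t x‖ₑ ^ 2 ≤ ∫⁻ x, ‖u 0 x‖ₑ ^ 2 := by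
  have hE := frame_finite_energy hu.2
  have hLH := (isLerayHopfOn_of_finiteEnergy hu.1 one_pos hT hE).1
  have h1 := hLH.lintegral_enorm_sq_le zero_le_one ht
  have hmem : MemLp (u 0) 2 volume := by
    obtain ⟨C, hC, hCb⟩ := hE
    refine ⟨(hu.1.contDiff_velocity ⟨le_rfl, hT.le⟩).continuous.aestronglyMeasurable, ?_⟩
    rw [eLpNorm_eq_lintegral_rpow_enorm_toReal two_ne_zero ENNReal.ofNat_ne_top]
    norm_num
    refine ENNReal.rpow_lt_top_of_nonneg (by norm_num) ((hCb 0 ⟨le_rfl, hT.le⟩).trans_lt hC).ne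
  rw [← eEnergy_eq_ofReal (u 0) hmem] at h1
  exact h1

/-! ## P4 by name -/

/-- **P4 BY NAME — `stub_exteriorCube : StubExteriorCube`** (piece P4 of the T1 anatomy of line `truncation_edge`, author ns-idea-7
g9; NS-generic).  Given the OUTER SUP BOUND `‖u(t,x)‖ ≤ K₀/ρ` for `‖x‖ ≥ ρ` (supplied by P3(c)) and the energy `‖u₀‖₂² ≤ K₁ρ` of the
datum, the exterior cube mass is bounded by INTERPOLATION alone:
`∫_{|x|>2ρ} |u(t)|³ ≤ sup_{|x|≥ρ}|u(t)| · ∫|u(t)|² ≤ (K₀/ρ)·‖u(t)‖₂² ≤ (K₀/ρ)·K₁ρ = K₀K₁` (energy inequality of Tao-frame solutions,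
`taoFrame_lintegral_enorm_sq_le`), so `k = (K₀K₁)^{1/3}` and `k³ = K₀K₁ ≤ K₀K₁(1 + log ρ)` for `ρ ≥ ρ₀ = 1` (`K := K₀K₁`) — no heat
leakage or off-diagonal Oseen bookkeeping is needed for the statement as typed. [this file; line piece P4 discharged] -/
theorem stub_exteriorCube : StubExteriorCube := by
  intro K₀ K₁ hK₀ hK₁
  refine ⟨1, K₀ * K₁, le_rfl, by positivity, ?_⟩
  intro ρ hρ u₀ _ _ _ hE0 _ T' hT' u p hu hu0 hout
  have hρ0 : 0 < ρ := by linarith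
  set k : ℝ := (K₀ * K₁) ^ (1 / 3 : ℝ) with hk
  have hk0 : 0 ≤ k := by positivity
  have hk3 : k ^ 3 = K₀ * K₁ := by
    rw [hk, ← Real.rpow_natCast, ← Real.rpow_mul (by positivity)]; norm_num
  refine ⟨k, hk0, ?_, fun t ht => ?_⟩
  · rw [hk3]
    have : 0 ≤ Real.log ρ := Real.log_nonneg hρ
    nlinarith [mul_nonneg hK₀ hK₁]
  -- the exterior cube at time `t`
  set S : Set (EuclideanSpace ℝ (Fin 3)) := (Metric.closedBall (0 : EuclideanSpace ℝ (Fin 3)) (2 * ρ))ᶜ with hS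
  have hSm : MeasurableSet S := measurableSet_closedBall.compl
  have henergy : ∫⁻ x, ‖u t x‖ₑ ^ 2 ≤ ENNReal.ofReal (K₁ * ρ) := by
    refine (taoFrame_lintegral_enorm_sq_le hu hT'.1 ht).trans ?_
    rw [hu0]; exact hE0
  -- pointwise on `S`: `‖u‖ₑ³ ≤ ofReal (K₀/ρ) · ‖u‖ₑ²`
  have hpt : ∀ x ∈ S, ‖u t x‖ₑ ^ (3 : ℝ) ≤ ENNReal.ofReal (K₀ / ρ) * ‖u t x‖ₑ ^ 2 := by
    intro x hx
    have hxρ : ρ ≤ ‖x‖ := by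
      rw [hS, mem_compl_iff, mem_closedBall_zero_iff, not_le] at hx; linarith
    have h1 : ‖u t x‖ ≤ K₀ / ρ := hout t ht x hxρ
    have e : ‖u t x‖ₑ ^ (3 : ℝ) = ENNReal.ofReal (‖u t x‖) * ‖u t x‖ₑ ^ 2 := by
      rw [ofReal_norm, show (3 : ℝ) = 1 + 2 by norm_num, ENNReal.rpow_add_of_nonneg _ _ (by norm_num) (by norm_num),
        ENNReal.rpow_one, ENNReal.rpow_two]
    rw [e]
    exact mul_le_mul' (ENNReal.ofReal_le_ofReal h1) le_rfl
  have hcube : ∫⁻ x, ‖S.indicator (u t) x‖ₑ ^ (3 : ℝ) ≤ ENNReal.ofReal (K₀ * K₁) := by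
    have e1 : (fun x => ‖S.indicator (u t) x‖ₑ ^ (3 : ℝ)) = S.indicator (fun x => ‖u t x‖ₑ ^ (3 : ℝ)) := by
      funext x
      by_cases hx : x ∈ S
      · simp [indicator_of_mem hx]
      · simp [indicator_of_notMem hx]
    rw [e1, lintegral_indicator hSm]
    calc ∫⁻ x in S, ‖u t x‖ₑ ^ (3 : ℝ) ≤ ∫⁻ x in S, ENNReal.ofReal (K₀ / ρ) * ‖u t x‖ₑ ^ 2 :=
          setLIntegral_mono' hSm fun x hx => hpt x hx
      _ = ENNReal.ofReal (K₀ / ρ) * ∫⁻ x in S, ‖u t x‖ₑ ^ 2 := by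
          rw [lintegral_const_mul' _ _ ENNReal.ofReal_ne_top]
      _ ≤ ENNReal.ofReal (K₀ / ρ) * ∫⁻ x, ‖u t x‖ₑ ^ 2 :=
          mul_le_mul' le_rfl (setLIntegral_le_lintegral _ _)
      _ ≤ ENNReal.ofReal (K₀ / ρ) * ENNReal.ofReal (K₁ * ρ) := mul_le_mul' le_rfl henergy
      _ = ENNReal.ofReal (K₀ * K₁) := by
          rw [← ENNReal.ofReal_mul (by positivity)]
          congr 1; field_simp
  rw [eLpNorm_eq_lintegral_rpow_enorm_toReal (by norm_num) ENNReal.ofNat_ne_top]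
  simp only [ENNReal.toReal_ofNat, one_div]
  calc (∫⁻ x, ‖S.indicator (u t) x‖ₑ ^ (3 : ℝ)) ^ (3⁻¹ : ℝ) ≤ (ENNReal.ofReal (K₀ * K₁)) ^ (3⁻¹ : ℝ) :=
        ENNReal.rpow_le_rpow hcube (by norm_num)
    _ = ENNReal.ofReal k := by
        rw [hk, ENNReal.ofReal_rpow_of_nonneg (by positivity) (by norm_num)]; norm_num

end Summit.NavierStokesRegularity.NavierStokesRegularity.Cruxes.TypeIQuantSubcubicExp.TruncationEdge

end
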